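import Summits.ResolutionOfSingularities.ResolutionOfSingularities.Theorems.HomologicalConductorPersistenceMonomialValuation
import Summits.ResolutionOfSingularities.ResolutionOfSingularities.Theorems.SyzygyFlatteningHigherRankTerminationTowerStageBasic
import HarnessLib

/-!
# Crux `Persistence` (stmt-ResolutionOfSingularities-16484), chain W4.4b K-C3 — K3a companion: the KC3 SPELLING v1 edition
# (`w = ![6, 5, 4]` on `k[x, z, t]`), «`k ⊆ O_w`», «`A ≤ O_w`» in the crux's own binder shapes, and `y = (z³ + t⁴)·x⁻¹ ∈ O_w`

Route `ResolutionOfSingularities/HomologicalConductor`. OURS (cell res-hironaka, chain W4.4b K-C3; res-L1-w44b-plan-1 ASSIGN v1.9 (E)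
«KC3 SPELLING v1» 2026-08-27T11:44:56Z: `K := FractionRing (MvPolynomial (Fin 3) k)`, `x z t := algebraMap _ K (X 0 / X 1 / X 2)`,
`A := Algebra.adjoin k {x, z, t, (z^3 + t^4) * x⁻¹}`, `O :=` the monomial valuation subring with weights `![6, 5, 4]`, and the ask
«084: please expose `O_w : ValuationSubring K`, `mem_O_iff`, `A ≤ O`, and v of a monomial = w·exponents»; seat res-type-084 g11).
Def-free companion of `HomologicalConductorPersistenceMonomialValuation.lean` (p528549: `monomialValuationRing`, `mem_monomialValuationRing_iff`,
`monomialValuation_monomial`, …). Everything is stated for ANY fraction field `K` of `k[X₀,X₁,X₂]` (`[Algebra (MvPolynomial (Fin 3) k) K]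
[IsFractionRing (MvPolynomial (Fin 3) k) K]`), so the SPELLING's `K := FractionRing _` is an instance by typeclass resolution.
Nothing here is a statement of the manuscript under review (Hironaka 2017); nothing concludes the crux; AI-written, weaker than expert review.

* §1 `monomialValuationFrac_monomial` / `_X_pow` (v of a monomial in `K`); the generic tool «`k ⊆ O`, `S ⊆ O` ⇒ `(Algebra.adjoin k S).toSubring
  ≤ O.toSubring`» is the tree's `SyzygyFlattening.adjoin_toSubring_le_valuationSubring` (`…TowerStageBasic.lean`, `k K : Type`), reused.
* §2 the K-C3 weights `kc3Weight N = ![6, 4+N, 3+N]` (SPELLING v1: `N = 1`, `kc3Weight_one_eq : kc3Weight 1 = ![6, 5, 4]`):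
  `v((z³+t⁴)·x⁻¹) = exp(−(6+3N))`, **`kc3_y_mem : (z³ + t⁴)·x⁻¹ ∈ O_w`**, **`kc3_algebraMap_base_mem`** (`∀ c : k, algebraMap k K c ∈ O_w`)
  and **`kc3_adjoin_toSubring_le`** (`(Algebra.adjoin k {x, z, t, (z^3+t^4)*x⁻¹}).toSubring ≤ O_w.toSubring`) — the two `O`-binders of
  `Persistence` at the K-C3 datum, in the SPELLING's term shapes; **`kc3_W_subset`** — «`W ⊆ O`» = the hypothesis `hWO` of res-D-pv-043's
  `PersistenceKC3TowerInstance.kc3_tower_one_eq` in its literal shape (the seven generators `x, z, t, z²x⁻¹, ztx⁻¹, t²x⁻¹, z³x⁻¹x⁻¹ ∈ O_w`);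
  `kc3_inv_algebraMap_mem_iff` (a polynomial is inverted in `O_w` iff its constant term is non-zero).
[folklore] throughout (elementary valuation bookkeeping); OURS data.
-/

noncomputable section

-- single-problem summit: the doubled namespace component `ResolutionOfSingularities` is forced
set_option linter.dupNamespace false

open MvPolynomial WithZero
open Literature.AlgebraicGeometry.Resolution.WeightedBlowup

namespace Summit.ResolutionOfSingularities.ResolutionOfSingularities.Theorems.HomologicalConductor.PersistenceMonomialValuation

universe u v w

/-! ## §1 Monomials in `K` (the tool «`k ⊆ O`, `S ⊆ O` ⇒ `Algebra.adjoin k S ⊆ O`» is the tree's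
`SyzygyFlattening.adjoin_toSubring_le_valuationSubring`, imported, not restated) -/

section Monomial

variable {σ : Type u} (k : Type v) [Field k] (w : σ → ℕ) (K : Type w) [Field K] [Algebra (MvPolynomial σ k) K]
  [IsFractionRing (MvPolynomial σ k) K]

/-- **v of a monomial in `K` = `exp (−Σ wᵢ dᵢ)`** (`c ≠ 0`). [folklore] -/
theorem monomialValuationFrac_monomial (d : σ →₀ ℕ) {c : k} (hc : c ≠ 0) :
    monomialValuationFrac k w K (algebraMap (MvPolynomial σ k) K (monomial d c)) = exp (-(Finsupp.weight w d : ℤ)) := by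
  rw [monomialValuationFrac_algebraMap, monomialValuation_monomial k w d hc]

/-- `v(xᵢ ^ n) = exp (−n·wᵢ)` in `K`. [folklore] -/
theorem monomialValuationFrac_X_pow (i : σ) (n : ℕ) :
    monomialValuationFrac k w K (algebraMap (MvPolynomial σ k) K (X i) ^ n) = exp (-((n * w i : ℕ) : ℤ)) := by
  rw [map_pow, monomialValuationFrac_X, ← exp_nsmul, Nat.cast_mul]
  congr 1
  ring

end Monomial

/-! ## §2 KC3 SPELLING v1: weights `kc3Weight N = ![6, 4+N, 3+N]` on `k[x, z, t]` (`x = X 0`, `z = X 1`, `t = X 2`; v1 uses `N = 1`) -/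

section Spelling

variable (k : Type) [Field k] (K : Type) [Field K] [Algebra (MvPolynomial (Fin 3) k) K] [IsFractionRing (MvPolynomial (Fin 3) k) K]
  (N : ℕ)  -- universe `0` as in the crux binders `(k K : Type)` and the reused `SyzygyFlattening` tool

/-- The SPELLING v1 weights `![6, 5, 4]` ARE `kc3Weight 1` (`![6, 4+1, 3+1]`): rewrite with this to use the `kc3Weight` lemmas. [folklore] -/
theorem kc3Weight_one_eq : kc3Weight 1 = ![6, 5, 4] := by
  ext i; fin_cases i <;> rfl

/-- **`v((z³ + t⁴)·x⁻¹) = exp(−(6 + 3N))`** in `K` (SPELLING shape of `y`; `exp(−9)` at `N = 1`). [folklore] -/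
theorem monomialValuationFrac_kc3_y :
    monomialValuationFrac k (kc3Weight N) K
        ((algebraMap (MvPolynomial (Fin 3) k) K (X 1) ^ 3 + algebraMap (MvPolynomial (Fin 3) k) K (X 2) ^ 4) *
          (algebraMap (MvPolynomial (Fin 3) k) K (X 0))⁻¹) = exp (-((6 + 3 * N : ℕ) : ℤ)) := by
  rw [← map_pow, ← map_pow, ← map_add, map_mul, map_inv₀, monomialValuationFrac_algebraMap, monomialValuationFrac_algebraMap,
    monomialValuation_zCube_add_tFour, monomialValuation_X, kc3Weight_zero, ← exp_neg, ← exp_add]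
  congr 1
  push_cast
  ring

/-- **`y = (z³ + t⁴)·x⁻¹ ∈ O_w`** (value `exp(−(6+3N)) ≤ 1`). [folklore] -/
theorem kc3_y_mem :
    (algebraMap (MvPolynomial (Fin 3) k) K (X 1) ^ 3 + algebraMap (MvPolynomial (Fin 3) k) K (X 2) ^ 4) *
        (algebraMap (MvPolynomial (Fin 3) k) K (X 0))⁻¹ ∈ monomialValuationRing k (kc3Weight N) K := by
  rw [mem_monomialValuationRing_iff, monomialValuationFrac_kc3_y, ← exp_zero, exp_le_exp]
  omega

/-- **«`k ⊆ O`» binder of `Persistence` at the K-C3 datum**: `∀ c : k, algebraMap k K c ∈ O_w`. [folklore] -/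
theorem kc3_algebraMap_base_mem [Algebra k K] [IsScalarTower k (MvPolynomial (Fin 3) k) K] (c : k) :
    algebraMap k K c ∈ monomialValuationRing k (kc3Weight N) K :=
  algebraMap_base_mem k _ K c

/-- **«`A ≤ O`» binder of `Persistence` at the K-C3 datum**: for `A := Algebra.adjoin k {x, z, t, (z³+t⁴)·x⁻¹}` (KC3 SPELLING v1),
`A.toSubring ≤ O_w.toSubring`. [folklore] -/
theorem kc3_adjoin_toSubring_le [Algebra k K] [IsScalarTower k (MvPolynomial (Fin 3) k) K] :
    (Algebra.adjoin k ({algebraMap (MvPolynomial (Fin 3) k) K (X 0), algebraMap (MvPolynomial (Fin 3) k) K (X 1),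
        algebraMap (MvPolynomial (Fin 3) k) K (X 2),
        (algebraMap (MvPolynomial (Fin 3) k) K (X 1) ^ 3 + algebraMap (MvPolynomial (Fin 3) k) K (X 2) ^ 4) *
          (algebraMap (MvPolynomial (Fin 3) k) K (X 0))⁻¹} : Set K)).toSubring ≤
      (monomialValuationRing k (kc3Weight N) K).toSubring := by
  refine SyzygyFlattening.adjoin_toSubring_le_valuationSubring _ (kc3_algebraMap_base_mem k K N) ?_
  intro y hy
  simp only [Set.mem_insert_iff, Set.mem_singleton_iff] at hy
  rcases hy with rfl | rfl | rfl | rfl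
  · exact algebraMap_mem k _ K _
  · exact algebraMap_mem k _ K _
  · exact algebraMap_mem k _ K _
  · exact kc3_y_mem k K N

/-- `F·G⁻¹ ∈ O_w ↔ v_w(F) ≤ v_w(G)` for polynomials `F`, `G ≠ 0` (the `* ⁻¹` shape of `div_algebraMap_mem_iff`). [folklore] -/
theorem kc3_mul_inv_mem_iff (F : MvPolynomial (Fin 3) k) {G : MvPolynomial (Fin 3) k} (hG : G ≠ 0) :
    algebraMap (MvPolynomial (Fin 3) k) K F * (algebraMap (MvPolynomial (Fin 3) k) K G)⁻¹ ∈ monomialValuationRing k (kc3Weight N) K ↔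
      monomialValuation k (kc3Weight N) F ≤ monomialValuation k (kc3Weight N) G := by
  rw [← div_eq_mul_inv, div_algebraMap_mem_iff k _ K F hG]

/-- **`z²·x⁻¹ ∈ O_w`** (value `exp(−(2+2N))`). [folklore] -/
theorem kc3_zSq_mul_xInv_mem :
    algebraMap (MvPolynomial (Fin 3) k) K (X 1) ^ 2 * (algebraMap (MvPolynomial (Fin 3) k) K (X 0))⁻¹ ∈
      monomialValuationRing k (kc3Weight N) K := by
  rw [← map_pow, kc3_mul_inv_mem_iff k K N _ (X_ne_zero 0), map_pow, monomialValuation_X, monomialValuation_X, ← exp_nsmul, exp_le_exp,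
    kc3Weight_zero, kc3Weight_one, nsmul_eq_mul]
  push_cast; omega

/-- **`z·t·x⁻¹ ∈ O_w`** (value `exp(−(1+2N))`). [folklore] -/
theorem kc3_z_mul_t_mul_xInv_mem :
    algebraMap (MvPolynomial (Fin 3) k) K (X 1) * algebraMap (MvPolynomial (Fin 3) k) K (X 2) *
        (algebraMap (MvPolynomial (Fin 3) k) K (X 0))⁻¹ ∈ monomialValuationRing k (kc3Weight N) K := by
  rw [← map_mul, kc3_mul_inv_mem_iff k K N _ (X_ne_zero 0), map_mul, monomialValuation_X, monomialValuation_X, monomialValuation_X,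
    ← exp_add, exp_le_exp, kc3Weight_zero, kc3Weight_one, kc3Weight_two]
  push_cast; omega

/-- **`t²·x⁻¹ ∈ O_w`** (value `exp(−2N)`; `= 1` at `N = 0`). [folklore] -/
theorem kc3_tSq_mul_xInv_mem :
    algebraMap (MvPolynomial (Fin 3) k) K (X 2) ^ 2 * (algebraMap (MvPolynomial (Fin 3) k) K (X 0))⁻¹ ∈
      monomialValuationRing k (kc3Weight N) K := by
  rw [← map_pow, kc3_mul_inv_mem_iff k K N _ (X_ne_zero 0), map_pow, monomialValuation_X, monomialValuation_X, ← exp_nsmul, exp_le_exp,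
    kc3Weight_zero, kc3Weight_two, nsmul_eq_mul]
  push_cast; omega

/-- **`z³·x⁻¹·x⁻¹ ∈ O_w`** (value `exp(−3N)`; the generator `b³` of the `μ₆(1,2,3)`-invariant chart). [folklore] -/
theorem kc3_zCube_mul_xInv_mul_xInv_mem :
    algebraMap (MvPolynomial (Fin 3) k) K (X 1) ^ 3 * (algebraMap (MvPolynomial (Fin 3) k) K (X 0))⁻¹ *
        (algebraMap (MvPolynomial (Fin 3) k) K (X 0))⁻¹ ∈ monomialValuationRing k (kc3Weight N) K := by
  rw [mul_assoc, ← mul_inv, ← pow_two, ← map_pow, ← map_pow, kc3_mul_inv_mem_iff k K N _ (pow_ne_zero 2 (X_ne_zero 0)), map_pow, map_pow,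
    monomialValuation_X, monomialValuation_X, ← exp_nsmul, ← exp_nsmul, exp_le_exp, kc3Weight_zero, kc3Weight_one, nsmul_eq_mul,
    nsmul_eq_mul]
  push_cast; omega

/-- **«`W ⊆ O`» for K3b** (`hWO` of `PersistenceKC3TowerInstance.kc3_tower_one_eq`, its literal shape):
`W = Algebra.adjoin k {x, z, t, z²x⁻¹, ztx⁻¹, t²x⁻¹, z³x⁻¹x⁻¹} ⊆ O_w` (`= k[a⁶, a⁴b, a³c, a²b², abc, c², b³]` under `x = a⁶, z = a⁴b, t = a³c`). [folklore] -/
theorem kc3_W_subset [Algebra k K] [IsScalarTower k (MvPolynomial (Fin 3) k) K] :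
    (Algebra.adjoin k ({algebraMap (MvPolynomial (Fin 3) k) K (X 0), algebraMap (MvPolynomial (Fin 3) k) K (X 1),
        algebraMap (MvPolynomial (Fin 3) k) K (X 2),
        algebraMap (MvPolynomial (Fin 3) k) K (X 1) ^ 2 * (algebraMap (MvPolynomial (Fin 3) k) K (X 0))⁻¹,
        algebraMap (MvPolynomial (Fin 3) k) K (X 1) * algebraMap (MvPolynomial (Fin 3) k) K (X 2) *
          (algebraMap (MvPolynomial (Fin 3) k) K (X 0))⁻¹,
        algebraMap (MvPolynomial (Fin 3) k) K (X 2) ^ 2 * (algebraMap (MvPolynomial (Fin 3) k) K (X 0))⁻¹,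
        algebraMap (MvPolynomial (Fin 3) k) K (X 1) ^ 3 * (algebraMap (MvPolynomial (Fin 3) k) K (X 0))⁻¹ *
          (algebraMap (MvPolynomial (Fin 3) k) K (X 0))⁻¹} : Set K) : Set K) ⊆ monomialValuationRing k (kc3Weight N) K := by
  intro y hy
  refine SyzygyFlattening.adjoin_toSubring_le_valuationSubring _ (kc3_algebraMap_base_mem k K N) ?_ hy
  intro u hu
  simp only [Set.mem_insert_iff, Set.mem_singleton_iff] at hu
  rcases hu with rfl | rfl | rfl | rfl | rfl | rfl | rfl
  · exact algebraMap_mem k _ K _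
  · exact algebraMap_mem k _ K _
  · exact algebraMap_mem k _ K _
  · exact kc3_zSq_mul_xInv_mem k K N
  · exact kc3_z_mul_t_mul_xInv_mem k K N
  · exact kc3_tSq_mul_xInv_mem k K N
  · exact kc3_zCube_mul_xInv_mul_xInv_mem k K N

/-- A non-zero polynomial is inverted in `O_w` iff its constant term is non-zero (K-C3 weights are positive) — the centre of `O_w` on
`k[x,z,t]` is the origin (REFEREE-KC3 L0/L6 bookkeeping). [folklore] -/
theorem kc3_inv_algebraMap_mem_iff {F : MvPolynomial (Fin 3) k} (hF : F ≠ 0) :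
    (algebraMap (MvPolynomial (Fin 3) k) K F)⁻¹ ∈ monomialValuationRing k (kc3Weight N) K ↔ constantCoeff F ≠ 0 :=
  inv_algebraMap_mem_iff k _ K (kc3Weight_ne_zero N) hF

/-- Every polynomial lies in `O_w` (pointer to `algebraMap_mem` at the K-C3 weights). [folklore] -/
theorem kc3_algebraMap_mem (F : MvPolynomial (Fin 3) k) :
    algebraMap (MvPolynomial (Fin 3) k) K F ∈ monomialValuationRing k (kc3Weight N) K :=
  algebraMap_mem k _ K F

end Spelling

end Summit.ResolutionOfSingularities.ResolutionOfSingularities.Theorems.HomologicalConductor.PersistenceMonomialValuation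

end
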